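import Mathlib.Tactic.Ring
import Mathlib.Tactic.Linarith
import Mathlib.Tactic.Positivity
import Mathlib.Tactic.LinearCombination
import Mathlib.Tactic.FieldSimp
import Mathlib.Data.Real.Basic
import Summits.HodgeConjecture.HodgeConjecture.Theorems.WeilClassTestFormatFiveThreeDoublyOneSided
import Summits.HodgeConjecture.HodgeConjecture.Theorems.WeilClassTestFormatFiveThreeDoublyOneSidedKey
import Summits.HodgeConjecture.HodgeConjecture.Theorems.WeilClassTestFormatFiveThreeDoublyOneSidedAllTilts
import HarnessLib

/-!
# Conjecture N (hodge-weil ladder, GAPS G51b/G51c), format (5,3): THE F₁-BRACKET `Ψ(1) ≥ 0` WITH ONE E-CHARGE ABOVE THE TOP F-CHARGE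

Prover 2, generation 16 (note `run/shared/lean/b2b/hodge-weil/b2b-hweil-pv2-g16/DOS-G16.md` ADDENDUM 1, A1.5). Setting of `CONJECTURE-N.md` §1
in format (5,3); pair formula of pv2-g15 for the extreme F-pair, `δ³(Q₂ + λQ₄) = 2(Ψ_λ(1) − Ψ_λ(3))`. In `WeilClassTestFormatFiveThreeDoublyOneSidedAllTilts`
the F₁-half `Ψ_{4/3}(1) ≥ 0` was proved when ALL five E-charges lie in `[v₁, v₃]`. Here the same is proved when `F₁` is weakly below all E-charges,
four of them lie in `[v₁, v₃]` and the fifth (`E₅`) lies weakly ABOVE `v₃` (the F₁-half of the charge classes `(0,·,4)`: patterns `FFEEEEFE`,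
`FEEFEEFE`, `FEEEEFFE`), for nonnegative tilt `Δ = B₃ − B₁ ≥ 0` (for `Δ ≤ 0` every term of `Ψ(1)` is nonnegative):
* `coeffs_pos4`, `key4` — the KEY charge lemma with one ratio `r₅ = (v₃−u₅)/(u₅−v₁) ∈ [−1, 0]`: `DD2 = 0 ⟹ 34∏b ≤ 5δ·Σ_{i≤4} b_{∖i}`
  (`Σ_{i≤4} δ/b_i ≥ 34/5`; numerically the infimum is 8), via the same identity `key_identity`;
* `psi_low_midTilt4` (`δ ≤ 3Δ ≤ 9δ`, given `key4`'s conclusion: `Ψ(1) ≥ ∏b·(−29Δ² + 117Δδ − 14δ²)/5 ≥ 0`), `psi_low_largeTilt4`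
  (`3Δ² + 3Δδ ≥ 8δ²`: `Ψ(1) = ∏b(3Δ²+3Δδ−8δ²) + (δ+2Δ)Σ_{i≤4}t_ib_{∖i} + 3Δ·t₅b_{∖5} + Σ_{i<j}t_it_jb_{∖ij}`, `t_i = δa_i − Δb_i ≥ 0` (i ≤ 4),
  `t₅ = δ(a₅ − b₅) ≥ 0`);
* **`psi1_nonneg_oneAbove`** — in the configuration variables: centring + (P4), `v₁ ≤ v₂ ≤ v₃`, `v₁ < v₃`, `B₁ ≤ B₃`, `v₁ ≤ u_e` (all e), `u_e ≤ v₃` (e ≤ 4),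
  `v₃ ≤ u₅`, ampleness w.r.t. `F₁` (all e) and w.r.t. `F₃` (e ≤ 4) ⟹ `Ψ_{4/3}(1) ≥ 0` (the `hlow` expression of `allTilts_main`). E₅'s ampleness w.r.t. `F₃`
  is not needed. This is half of the classes `(0,·,4)`; their F₃-bracket is NOT signed (note A1.3), so no pattern is closed by this file alone.
Pure algebra; nothing here is a case of HC, a rung or a door edge; no statement of Markman's papers is used. New cell result ⇒ Summits/.
-/

set_option linter.dupNamespace false

open Summit.HodgeConjecture.HodgeConjecture.WeilClassTestFormatFiveThreeDoublyOneSided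
open Summit.HodgeConjecture.HodgeConjecture.WeilClassTestFormatFiveThreeDoublyOneSidedKey
open Summit.HodgeConjecture.HodgeConjecture.WeilClassTestFormatFiveThreeDoublyOneSidedAllTilts

namespace Summit.HodgeConjecture.HodgeConjecture.WeilClassTestFormatFiveThreeLowBracket

/-- Coefficient positivity with one nonpositive ratio: `r₁..r₄ ≥ 0`, `−1 ≤ r₅ ≤ 0`, `r₁+r₂+r₃+r₄ < 14/5` ⟹ the four coefficients
`c₀ = 4 + e₁ − e₅`, `c₁ = 6 − e₂ − 4e₅`, `c₂ = 4 + e₃ − 6e₅`, `c₃ = 1 − e₄ − 4e₅` of `e_k(r₁,…,r₅)` are positive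
(`e₂(r₁..r₄) ≤ 3s²/8`, `r₁r₂r₃r₄ ≤ (s/4)⁴`, and every `r₅`-term has the good sign). -/
theorem coeffs_pos4 (r₁ r₂ r₃ r₄ r₅ : ℝ) (h₁ : 0 ≤ r₁) (h₂ : 0 ≤ r₂) (h₃ : 0 ≤ r₃) (h₄ : 0 ≤ r₄) (h₅ : r₅ ≤ 0) (h₅' : -1 ≤ r₅)
    (hs : r₁ + r₂ + r₃ + r₄ < 14 / 5) :
    0 < (4 + (r₁ + r₂ + r₃ + r₄ + r₅) - r₁ * r₂ * r₃ * r₄ * r₅)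
    ∧ 0 < (6 - (r₁ * r₂ + r₁ * r₃ + r₁ * r₄ + r₁ * r₅ + r₂ * r₃ + r₂ * r₄ + r₂ * r₅ + r₃ * r₄ + r₃ * r₅ + r₄ * r₅) - 4 * (r₁ * r₂ * r₃ * r₄ * r₅))
    ∧ 0 < (4 + (r₁ * r₂ * r₃ + r₁ * r₂ * r₄ + r₁ * r₂ * r₅ + r₁ * r₃ * r₄ + r₁ * r₃ * r₅ + r₁ * r₄ * r₅ + r₂ * r₃ * r₄ + r₂ * r₃ * r₅ + r₂ * r₄ * r₅ + r₃ * r₄ * r₅) - 6 * (r₁ * r₂ * r₃ * r₄ * r₅))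
    ∧ 0 < (1 - (r₂ * r₃ * r₄ * r₅ + r₁ * r₃ * r₄ * r₅ + r₁ * r₂ * r₄ * r₅ + r₁ * r₂ * r₃ * r₅ + r₁ * r₂ * r₃ * r₄) - 4 * (r₁ * r₂ * r₃ * r₄ * r₅)) := by
  have hs0 : 0 ≤ r₁ + r₂ + r₃ + r₄ := by positivity
  -- e₂(r₁..r₄) ≤ 3 s² / 8 < 3
  have he2 : r₁ * r₂ + r₁ * r₃ + r₁ * r₄ + r₂ * r₃ + r₂ * r₄ + r₃ * r₄ ≤ 3 := by
    have e : 3 * (r₁ + r₂ + r₃ + r₄) ^ 2 - 8 * (r₁ * r₂ + r₁ * r₃ + r₁ * r₄ + r₂ * r₃ + r₂ * r₄ + r₃ * r₄)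
        = (r₁ - r₂) ^ 2 + (r₁ - r₃) ^ 2 + (r₁ - r₄) ^ 2 + (r₂ - r₃) ^ 2 + (r₂ - r₄) ^ 2 + (r₃ - r₄) ^ 2 := by ring
    have p : 0 ≤ (r₁ - r₂) ^ 2 + (r₁ - r₃) ^ 2 + (r₁ - r₄) ^ 2 + (r₂ - r₃) ^ 2 + (r₂ - r₄) ^ 2 + (r₃ - r₄) ^ 2 := by positivity
    have sq : (r₁ + r₂ + r₃ + r₄) ^ 2 ≤ (14 / 5 : ℝ) ^ 2 := pow_le_pow_left₀ hs0 hs.le 2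
    nlinarith [e, p, sq]
  -- e₄(r₁..r₄) ≤ (s/4)⁴ ≤ (7/10)⁴
  have he4 : r₁ * r₂ * r₃ * r₄ ≤ 2401 / 10000 := by
    have a := amgm4 r₁ r₂ r₃ r₄ h₁ h₂ h₃ h₄
    have b : ((r₁ + r₂ + r₃ + r₄) / 4) ^ 4 ≤ (7 / 10 : ℝ) ^ 4 := pow_le_pow_left₀ (by positivity) (by linarith) 4
    have c : (7 / 10 : ℝ) ^ 4 = 2401 / 10000 := by norm_num
    linarith
  -- signs of the r₅-terms
  have m1 : 0 ≤ -r₅ := by linarith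
  have hE1 : 0 ≤ r₁ + r₂ + r₃ + r₄ := hs0
  have hE2 : 0 ≤ r₁ * r₂ + r₁ * r₃ + r₁ * r₄ + r₂ * r₃ + r₂ * r₄ + r₃ * r₄ := by positivity
  have hE3 : 0 ≤ r₁ * r₂ * r₃ + r₁ * r₂ * r₄ + r₁ * r₃ * r₄ + r₂ * r₃ * r₄ := by positivity
  have hE4 : 0 ≤ r₂ * r₃ * r₄ + r₁ * r₃ * r₄ + r₁ * r₂ * r₄ + r₁ * r₂ * r₃ := by positivity
  have hP4 : 0 ≤ r₁ * r₂ * r₃ * r₄ := by positivity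
  have q1 : 0 ≤ (-r₅) * (r₁ + r₂ + r₃ + r₄) := mul_nonneg m1 hE1
  have q2 : 0 ≤ (-r₅) * (r₁ * r₂ + r₁ * r₃ + r₁ * r₄ + r₂ * r₃ + r₂ * r₄ + r₃ * r₄) := mul_nonneg m1 hE2
  have q2' : (-r₅) * (r₁ * r₂ + r₁ * r₃ + r₁ * r₄ + r₂ * r₃ + r₂ * r₄ + r₃ * r₄)
      ≤ 1 * (r₁ * r₂ + r₁ * r₃ + r₁ * r₄ + r₂ * r₃ + r₂ * r₄ + r₃ * r₄) := mul_le_mul_of_nonneg_right (by linarith) hE2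
  have q3 : 0 ≤ (-r₅) * (r₁ * r₂ * r₃ + r₁ * r₂ * r₄ + r₁ * r₃ * r₄ + r₂ * r₃ * r₄) := mul_nonneg m1 hE3
  have q4 : 0 ≤ (-r₅) * (r₁ * r₂ * r₃ * r₄) := mul_nonneg m1 hP4
  refine ⟨by nlinarith [q4], by nlinarith [q1, q4, he2], by nlinarith [q2, q2', q4, he2, hE3], by nlinarith [q3, q4, he4]⟩

/-- **KEY CHARGE LEMMA, one E-charge above the top F-charge.** `0 ≤ b_i ≤ δ` (i ≤ 4), `δ ≤ b₅`, `0 ≤ x ≤ δ`, `δ > 0`, `DD2 = 0` ⟹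
`34·∏b ≤ 5δ·Σ_{i≤4} b_{∖i}` (i.e. `Σ_{i≤4} δ/b_i ≥ 34/5`; the constraint-set infimum is 8). -/
theorem key4 (b₁ b₂ b₃ b₄ b₅ δ x : ℝ)
    (hb₁ : 0 ≤ b₁) (hb₂ : 0 ≤ b₂) (hb₃ : 0 ≤ b₃) (hb₄ : 0 ≤ b₄)
    (hc₁ : b₁ ≤ δ) (hc₂ : b₂ ≤ δ) (hc₃ : b₃ ≤ δ) (hc₄ : b₄ ≤ δ) (hc₅ : δ ≤ b₅)
    (hx : 0 ≤ x) (hxδ : x ≤ δ) (hδ : 0 < δ)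
    (hDD : (b₃ - δ) * (b₄ - δ) * (b₅ - δ)
        + (b₂ - x) * (b₄ - δ) * (b₅ - δ)
        + (b₂ - x) * (b₃ - x) * (b₅ - δ)
        + (b₂ - x) * (b₃ - x) * (b₄ - x)
        + b₁ * (b₄ - δ) * (b₅ - δ)
        + b₁ * (b₃ - x) * (b₅ - δ)
        + b₁ * (b₃ - x) * (b₄ - x)
        + b₁ * b₂ * (b₅ - δ)
        + b₁ * b₂ * (b₄ - x)
        + b₁ * b₂ * b₃ = 0) :
    34 * (b₁ * b₂ * b₃ * b₄ * b₅) ≤ 5 * δ * (b₂ * b₃ * b₄ * b₅ + b₁ * b₃ * b₄ * b₅ + b₁ * b₂ * b₄ * b₅ + b₁ * b₂ * b₃ * b₅) := by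
  by_contra hcon
  push Not at hcon
  have hb₅ : 0 ≤ b₅ := le_trans hδ.le hc₅
  have hS : 0 ≤ b₂ * b₃ * b₄ * b₅ + b₁ * b₃ * b₄ * b₅ + b₁ * b₂ * b₄ * b₅ + b₁ * b₂ * b₃ * b₅ := by positivity
  have hP : 0 < b₁ * b₂ * b₃ * b₄ * b₅ := by nlinarith
  have hp₁ : 0 < b₁ := lt_of_le_of_ne hb₁ (by rintro h; rw [← h] at hP; simp at hP)
  have hp₂ : 0 < b₂ := lt_of_le_of_ne hb₂ (by rintro h; rw [← h] at hP; simp at hP)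
  have hp₃ : 0 < b₃ := lt_of_le_of_ne hb₃ (by rintro h; rw [← h] at hP; simp at hP)
  have hp₄ : 0 < b₄ := lt_of_le_of_ne hb₄ (by rintro h; rw [← h] at hP; simp at hP)
  have hp₅ : 0 < b₅ := lt_of_lt_of_le hδ hc₅
  obtain ⟨r₁, hr₁⟩ : ∃ r : ℝ, r = (δ - b₁) / b₁ := ⟨_, rfl⟩
  obtain ⟨r₂, hr₂⟩ : ∃ r : ℝ, r = (δ - b₂) / b₂ := ⟨_, rfl⟩
  obtain ⟨r₃, hr₃⟩ : ∃ r : ℝ, r = (δ - b₃) / b₃ := ⟨_, rfl⟩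
  obtain ⟨r₄, hr₄⟩ : ∃ r : ℝ, r = (δ - b₄) / b₄ := ⟨_, rfl⟩
  obtain ⟨r₅, hr₅⟩ : ∃ r : ℝ, r = (δ - b₅) / b₅ := ⟨_, rfl⟩
  have hne₁ : b₁ ≠ 0 := ne_of_gt hp₁
  have hne₂ : b₂ ≠ 0 := ne_of_gt hp₂
  have hne₃ : b₃ ≠ 0 := ne_of_gt hp₃
  have hne₄ : b₄ ≠ 0 := ne_of_gt hp₄
  have hne₅ : b₅ ≠ 0 := ne_of_gt hp₅
  have h₁ : 0 ≤ r₁ := by rw [hr₁]; exact div_nonneg (by linarith) hb₁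
  have h₂ : 0 ≤ r₂ := by rw [hr₂]; exact div_nonneg (by linarith) hb₂
  have h₃ : 0 ≤ r₃ := by rw [hr₃]; exact div_nonneg (by linarith) hb₃
  have h₄ : 0 ≤ r₄ := by rw [hr₄]; exact div_nonneg (by linarith) hb₄
  have h₅ : r₅ ≤ 0 := by rw [hr₅]; exact div_nonpos_of_nonpos_of_nonneg (by linarith) hb₅
  have h₅' : -1 ≤ r₅ := by
    rw [hr₅, le_div_iff₀ hp₅]; linarith
  have k₁ : δ - b₁ = b₁ * r₁ := by rw [hr₁]; field_simp
  have k₂ : δ - b₂ = b₂ * r₂ := by rw [hr₂]; field_simp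
  have k₃ : δ - b₃ = b₃ * r₃ := by rw [hr₃]; field_simp
  have k₄ : δ - b₄ = b₄ * r₄ := by rw [hr₄]; field_simp
  have k₅ : δ - b₅ = b₅ * r₅ := by rw [hr₅]; field_simp
  -- Σ_(i≤4) r_i < 14/5
  have hsum : (r₁ + r₂ + r₃ + r₄) * (b₁ * b₂ * b₃ * b₄ * b₅) = δ * (b₂ * b₃ * b₄ * b₅ + b₁ * b₃ * b₄ * b₅ + b₁ * b₂ * b₄ * b₅ + b₁ * b₂ * b₃ * b₅) - 4 * (b₁ * b₂ * b₃ * b₄ * b₅) := by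
    have e : (r₁ + r₂ + r₃ + r₄) * (b₁ * b₂ * b₃ * b₄ * b₅)
        = (b₁ * r₁) * (b₂ * b₃ * b₄ * b₅) + (b₂ * r₂) * (b₁ * b₃ * b₄ * b₅) + (b₃ * r₃) * (b₁ * b₂ * b₄ * b₅) + (b₄ * r₄) * (b₁ * b₂ * b₃ * b₅) := by ring
    rw [e, ← k₁, ← k₂, ← k₃, ← k₄]; ring
  have hs : r₁ + r₂ + r₃ + r₄ < 14 / 5 := by
    by_contra hge
    push Not at hge
    have := mul_le_mul_of_nonneg_right hge hP.le
    linarith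
  obtain ⟨c0, c1, c2, c3⟩ := coeffs_pos4 r₁ r₂ r₃ r₄ r₅ h₁ h₂ h₃ h₄ h₅ h₅' hs
  have hC0 : 0 < (4 * (b₁ * b₂ * b₃ * b₄ * b₅)
        + ((δ - b₁) * (b₂ * b₃ * b₄ * b₅) + (δ - b₂) * (b₁ * b₃ * b₄ * b₅) + (δ - b₃) * (b₁ * b₂ * b₄ * b₅) + (δ - b₄) * (b₁ * b₂ * b₃ * b₅) + (δ - b₅) * (b₁ * b₂ * b₃ * b₄))
        - (δ - b₁) * (δ - b₂) * (δ - b₃) * (δ - b₄) * (δ - b₅)) := by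
    have e : (4 * (b₁ * b₂ * b₃ * b₄ * b₅)
        + ((δ - b₁) * (b₂ * b₃ * b₄ * b₅) + (δ - b₂) * (b₁ * b₃ * b₄ * b₅) + (δ - b₃) * (b₁ * b₂ * b₄ * b₅) + (δ - b₄) * (b₁ * b₂ * b₃ * b₅) + (δ - b₅) * (b₁ * b₂ * b₃ * b₄))
        - (δ - b₁) * (δ - b₂) * (δ - b₃) * (δ - b₄) * (δ - b₅))
        = (b₁ * b₂ * b₃ * b₄ * b₅) * (4 + (r₁ + r₂ + r₃ + r₄ + r₅) - r₁ * r₂ * r₃ * r₄ * r₅) := by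
      rw [k₁, k₂, k₃, k₄, k₅]; ring
    rw [e]; exact mul_pos hP c0
  have hC1 : 0 < (6 * (b₁ * b₂ * b₃ * b₄ * b₅)
        - ((δ - b₁) * (δ - b₂) * (b₃ * b₄ * b₅) + (δ - b₁) * (δ - b₃) * (b₂ * b₄ * b₅) + (δ - b₁) * (δ - b₄) * (b₂ * b₃ * b₅) + (δ - b₁) * (δ - b₅) * (b₂ * b₃ * b₄) + (δ - b₂) * (δ - b₃) * (b₁ * b₄ * b₅) + (δ - b₂) * (δ - b₄) * (b₁ * b₃ * b₅) + (δ - b₂) * (δ - b₅) * (b₁ * b₃ * b₄) + (δ - b₃) * (δ - b₄) * (b₁ * b₂ * b₅) + (δ - b₃) * (δ - b₅) * (b₁ * b₂ * b₄) + (δ - b₄) * (δ - b₅) * (b₁ * b₂ * b₃))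
        - 4 * ((δ - b₁) * (δ - b₂) * (δ - b₃) * (δ - b₄) * (δ - b₅))) := by
    have e : (6 * (b₁ * b₂ * b₃ * b₄ * b₅)
        - ((δ - b₁) * (δ - b₂) * (b₃ * b₄ * b₅) + (δ - b₁) * (δ - b₃) * (b₂ * b₄ * b₅) + (δ - b₁) * (δ - b₄) * (b₂ * b₃ * b₅) + (δ - b₁) * (δ - b₅) * (b₂ * b₃ * b₄) + (δ - b₂) * (δ - b₃) * (b₁ * b₄ * b₅) + (δ - b₂) * (δ - b₄) * (b₁ * b₃ * b₅) + (δ - b₂) * (δ - b₅) * (b₁ * b₃ * b₄) + (δ - b₃) * (δ - b₄) * (b₁ * b₂ * b₅) + (δ - b₃) * (δ - b₅) * (b₁ * b₂ * b₄) + (δ - b₄) * (δ - b₅) * (b₁ * b₂ * b₃))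
        - 4 * ((δ - b₁) * (δ - b₂) * (δ - b₃) * (δ - b₄) * (δ - b₅)))
        = (b₁ * b₂ * b₃ * b₄ * b₅) * (6 - (r₁ * r₂ + r₁ * r₃ + r₁ * r₄ + r₁ * r₅ + r₂ * r₃ + r₂ * r₄ + r₂ * r₅ + r₃ * r₄ + r₃ * r₅ + r₄ * r₅) - 4 * (r₁ * r₂ * r₃ * r₄ * r₅)) := by
      rw [k₁, k₂, k₃, k₄, k₅]; ring
    rw [e]; exact mul_pos hP c1
  have hC2 : 0 < (4 * (b₁ * b₂ * b₃ * b₄ * b₅)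
        + ((δ - b₃) * (δ - b₄) * (δ - b₅) * (b₁ * b₂) + (δ - b₂) * (δ - b₄) * (δ - b₅) * (b₁ * b₃) + (δ - b₂) * (δ - b₃) * (δ - b₅) * (b₁ * b₄) + (δ - b₂) * (δ - b₃) * (δ - b₄) * (b₁ * b₅) + (δ - b₁) * (δ - b₄) * (δ - b₅) * (b₂ * b₃) + (δ - b₁) * (δ - b₃) * (δ - b₅) * (b₂ * b₄) + (δ - b₁) * (δ - b₃) * (δ - b₄) * (b₂ * b₅) + (δ - b₁) * (δ - b₂) * (δ - b₅) * (b₃ * b₄) + (δ - b₁) * (δ - b₂) * (δ - b₄) * (b₃ * b₅) + (δ - b₁) * (δ - b₂) * (δ - b₃) * (b₄ * b₅))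
        - 6 * ((δ - b₁) * (δ - b₂) * (δ - b₃) * (δ - b₄) * (δ - b₅))) := by
    have e : (4 * (b₁ * b₂ * b₃ * b₄ * b₅)
        + ((δ - b₃) * (δ - b₄) * (δ - b₅) * (b₁ * b₂) + (δ - b₂) * (δ - b₄) * (δ - b₅) * (b₁ * b₃) + (δ - b₂) * (δ - b₃) * (δ - b₅) * (b₁ * b₄) + (δ - b₂) * (δ - b₃) * (δ - b₄) * (b₁ * b₅) + (δ - b₁) * (δ - b₄) * (δ - b₅) * (b₂ * b₃) + (δ - b₁) * (δ - b₃) * (δ - b₅) * (b₂ * b₄) + (δ - b₁) * (δ - b₃) * (δ - b₄) * (b₂ * b₅) + (δ - b₁) * (δ - b₂) * (δ - b₅) * (b₃ * b₄) + (δ - b₁) * (δ - b₂) * (δ - b₄) * (b₃ * b₅) + (δ - b₁) * (δ - b₂) * (δ - b₃) * (b₄ * b₅))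
        - 6 * ((δ - b₁) * (δ - b₂) * (δ - b₃) * (δ - b₄) * (δ - b₅)))
        = (b₁ * b₂ * b₃ * b₄ * b₅) * (4 + (r₁ * r₂ * r₃ + r₁ * r₂ * r₄ + r₁ * r₂ * r₅ + r₁ * r₃ * r₄ + r₁ * r₃ * r₅ + r₁ * r₄ * r₅ + r₂ * r₃ * r₄ + r₂ * r₃ * r₅ + r₂ * r₄ * r₅ + r₃ * r₄ * r₅) - 6 * (r₁ * r₂ * r₃ * r₄ * r₅)) := by
      rw [k₁, k₂, k₃, k₄, k₅]; ring
    rw [e]; exact mul_pos hP c2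
  have hC3 : 0 < ((b₁ * b₂ * b₃ * b₄ * b₅)
        - (b₁ * ((δ - b₂) * (δ - b₃) * (δ - b₄) * (δ - b₅)) + b₂ * ((δ - b₁) * (δ - b₃) * (δ - b₄) * (δ - b₅)) + b₃ * ((δ - b₁) * (δ - b₂) * (δ - b₄) * (δ - b₅)) + b₄ * ((δ - b₁) * (δ - b₂) * (δ - b₃) * (δ - b₅)) + b₅ * ((δ - b₁) * (δ - b₂) * (δ - b₃) * (δ - b₄)))
        - 4 * ((δ - b₁) * (δ - b₂) * (δ - b₃) * (δ - b₄) * (δ - b₅))) := by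
    have e : ((b₁ * b₂ * b₃ * b₄ * b₅)
        - (b₁ * ((δ - b₂) * (δ - b₃) * (δ - b₄) * (δ - b₅)) + b₂ * ((δ - b₁) * (δ - b₃) * (δ - b₄) * (δ - b₅)) + b₃ * ((δ - b₁) * (δ - b₂) * (δ - b₄) * (δ - b₅)) + b₄ * ((δ - b₁) * (δ - b₂) * (δ - b₃) * (δ - b₅)) + b₅ * ((δ - b₁) * (δ - b₂) * (δ - b₃) * (δ - b₄)))
        - 4 * ((δ - b₁) * (δ - b₂) * (δ - b₃) * (δ - b₄) * (δ - b₅)))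
        = (b₁ * b₂ * b₃ * b₄ * b₅) * (1 - (r₂ * r₃ * r₄ * r₅ + r₁ * r₃ * r₄ * r₅ + r₁ * r₂ * r₄ * r₅ + r₁ * r₂ * r₃ * r₅ + r₁ * r₂ * r₃ * r₄) - 4 * (r₁ * r₂ * r₃ * r₄ * r₅)) := by
      rw [k₁, k₂, k₃, k₄, k₅]; ring
    rw [e]; exact mul_pos hP c3
  have hid := key_identity b₁ b₂ b₃ b₄ b₅ δ x
  rw [hDD, mul_zero] at hid
  have hxb : 0 ≤ δ - x := by linarith
  generalize hA0 : (4 * (b₁ * b₂ * b₃ * b₄ * b₅)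
        + ((δ - b₁) * (b₂ * b₃ * b₄ * b₅) + (δ - b₂) * (b₁ * b₃ * b₄ * b₅) + (δ - b₃) * (b₁ * b₂ * b₄ * b₅) + (δ - b₄) * (b₁ * b₂ * b₃ * b₅) + (δ - b₅) * (b₁ * b₂ * b₃ * b₄))
        - (δ - b₁) * (δ - b₂) * (δ - b₃) * (δ - b₄) * (δ - b₅)) = A0 at hid hC0
  generalize hA1 : (6 * (b₁ * b₂ * b₃ * b₄ * b₅)
        - ((δ - b₁) * (δ - b₂) * (b₃ * b₄ * b₅) + (δ - b₁) * (δ - b₃) * (b₂ * b₄ * b₅) + (δ - b₁) * (δ - b₄) * (b₂ * b₃ * b₅) + (δ - b₁) * (δ - b₅) * (b₂ * b₃ * b₄) + (δ - b₂) * (δ - b₃) * (b₁ * b₄ * b₅) + (δ - b₂) * (δ - b₄) * (b₁ * b₃ * b₅) + (δ - b₂) * (δ - b₅) * (b₁ * b₃ * b₄) + (δ - b₃) * (δ - b₄) * (b₁ * b₂ * b₅) + (δ - b₃) * (δ - b₅) * (b₁ * b₂ * b₄) + (δ - b₄) * (δ - b₅) * (b₁ * b₂ * b₃))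
        - 4 * ((δ - b₁) * (δ - b₂) * (δ - b₃) * (δ - b₄) * (δ - b₅))) = A1 at hid hC1
  generalize hA2 : (4 * (b₁ * b₂ * b₃ * b₄ * b₅)
        + ((δ - b₃) * (δ - b₄) * (δ - b₅) * (b₁ * b₂) + (δ - b₂) * (δ - b₄) * (δ - b₅) * (b₁ * b₃) + (δ - b₂) * (δ - b₃) * (δ - b₅) * (b₁ * b₄) + (δ - b₂) * (δ - b₃) * (δ - b₄) * (b₁ * b₅) + (δ - b₁) * (δ - b₄) * (δ - b₅) * (b₂ * b₃) + (δ - b₁) * (δ - b₃) * (δ - b₅) * (b₂ * b₄) + (δ - b₁) * (δ - b₃) * (δ - b₄) * (b₂ * b₅) + (δ - b₁) * (δ - b₂) * (δ - b₅) * (b₃ * b₄) + (δ - b₁) * (δ - b₂) * (δ - b₄) * (b₃ * b₅) + (δ - b₁) * (δ - b₂) * (δ - b₃) * (b₄ * b₅))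
        - 6 * ((δ - b₁) * (δ - b₂) * (δ - b₃) * (δ - b₄) * (δ - b₅))) = A2 at hid hC2
  generalize hA3 : ((b₁ * b₂ * b₃ * b₄ * b₅)
        - (b₁ * ((δ - b₂) * (δ - b₃) * (δ - b₄) * (δ - b₅)) + b₂ * ((δ - b₁) * (δ - b₃) * (δ - b₄) * (δ - b₅)) + b₃ * ((δ - b₁) * (δ - b₂) * (δ - b₄) * (δ - b₅)) + b₄ * ((δ - b₁) * (δ - b₂) * (δ - b₃) * (δ - b₅)) + b₅ * ((δ - b₁) * (δ - b₂) * (δ - b₃) * (δ - b₄)))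
        - 4 * ((δ - b₁) * (δ - b₂) * (δ - b₃) * (δ - b₄) * (δ - b₅))) = A3 at hid hC3
  have t0 : 0 ≤ A0 * (δ - x) ^ 3 := mul_nonneg hC0.le (pow_nonneg hxb 3)
  have t1 : 0 ≤ A1 * x * (δ - x) ^ 2 := mul_nonneg (mul_nonneg hC1.le hx) (pow_nonneg hxb 2)
  have t2 : 0 ≤ A2 * x ^ 2 * (δ - x) := mul_nonneg (mul_nonneg hC2.le (pow_nonneg hx 2)) hxb
  have t3 : 0 ≤ A3 * x ^ 3 := mul_nonneg hC3.le (pow_nonneg hx 3)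
  have e0 : A0 * (δ - x) ^ 3 = 0 := by linarith
  have e3 : A3 * x ^ 3 = 0 := by linarith
  have f0 : (δ - x) ^ 3 = 0 := by
    rcases mul_eq_zero.mp e0 with h | h
    · linarith
    · exact h
  have f3 : x ^ 3 = 0 := by
    rcases mul_eq_zero.mp e3 with h | h
    · linarith
    · exact h
  have g0 : δ - x = 0 := pow_eq_zero_iff (n := 3) (by norm_num) |>.mp f0
  have g3 : x = 0 := pow_eq_zero_iff (n := 3) (by norm_num) |>.mp f3
  linarith

/-- MID TILT, one E-charge above: `Ψ_{4/3}(1) ≥ 0` when `δ ≤ 3Δ ≤ 9δ`, given `key4`'s conclusion; only the four E-charges in `[v₁,v₃]`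
need the F₃-slack bound `d_i ≥ δ + Δ − 2b_i`, the fifth only `d₅ ≥ 0`. -/
theorem psi_low_midTilt4 (b₁ b₂ b₃ b₄ b₅ d₁ d₂ d₃ d₄ d₅ δ Δ : ℝ)
    (hb₁ : 0 ≤ b₁) (hb₂ : 0 ≤ b₂) (hb₃ : 0 ≤ b₃) (hb₄ : 0 ≤ b₄) (hb₅ : 0 ≤ b₅)
    (hd₁ : 0 ≤ d₁) (hd₂ : 0 ≤ d₂) (hd₃ : 0 ≤ d₃) (hd₄ : 0 ≤ d₄) (hd₅ : 0 ≤ d₅)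
    (hq₁ : δ + Δ - 2 * b₁ ≤ d₁) (hq₂ : δ + Δ - 2 * b₂ ≤ d₂) (hq₃ : δ + Δ - 2 * b₃ ≤ d₃) (hq₄ : δ + Δ - 2 * b₄ ≤ d₄)
    (hδ : 0 ≤ δ) (hlo : δ ≤ 3 * Δ) (hhi : Δ ≤ 3 * δ)
    (hkey : 34 * (b₁ * b₂ * b₃ * b₄ * b₅) ≤ 5 * δ * (b₂ * b₃ * b₄ * b₅ + b₁ * b₃ * b₄ * b₅ + b₁ * b₂ * b₄ * b₅ + b₁ * b₂ * b₃ * b₅)) :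
    0 ≤ δ ^ 2 * ((b₁ + d₁) * (b₂ + d₂) * b₃ * b₄ * b₅ + (b₁ + d₁) * (b₃ + d₃) * b₂ * b₄ * b₅ + (b₁ + d₁) * (b₄ + d₄) * b₂ * b₃ * b₅ + (b₁ + d₁) * (b₅ + d₅) * b₂ * b₃ * b₄ + (b₂ + d₂) * (b₃ + d₃) * b₁ * b₄ * b₅ + (b₂ + d₂) * (b₄ + d₄) * b₁ * b₃ * b₅ + (b₂ + d₂) * (b₅ + d₅) * b₁ * b₃ * b₄ + (b₃ + d₃) * (b₄ + d₄) * b₁ * b₂ * b₅ + (b₃ + d₃) * (b₅ + d₅) * b₁ * b₂ * b₄ + (b₄ + d₄) * (b₅ + d₅) * b₁ * b₂ * b₃)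
      - δ * Δ * ((b₁ + d₁) * b₂ * b₃ * b₄ * b₅ + (b₂ + d₂) * b₁ * b₃ * b₄ * b₅ + (b₃ + d₃) * b₁ * b₂ * b₄ * b₅ + (b₄ + d₄) * b₁ * b₂ * b₃ * b₅ + (b₅ + d₅) * b₁ * b₂ * b₃ * b₄)
      + (Δ ^ 2 - 8 * δ ^ 2) * (b₁ * b₂ * b₃ * b₄ * b₅) := by
  have e : δ ^ 2 * ((b₁ + d₁) * (b₂ + d₂) * b₃ * b₄ * b₅ + (b₁ + d₁) * (b₃ + d₃) * b₂ * b₄ * b₅ + (b₁ + d₁) * (b₄ + d₄) * b₂ * b₃ * b₅ + (b₁ + d₁) * (b₅ + d₅) * b₂ * b₃ * b₄ + (b₂ + d₂) * (b₃ + d₃) * b₁ * b₄ * b₅ + (b₂ + d₂) * (b₄ + d₄) * b₁ * b₃ * b₅ + (b₂ + d₂) * (b₅ + d₅) * b₁ * b₃ * b₄ + (b₃ + d₃) * (b₄ + d₄) * b₁ * b₂ * b₅ + (b₃ + d₃) * (b₅ + d₅) * b₁ * b₂ * b₄ + (b₄ + d₄) * (b₅ + d₅) * b₁ * b₂ * 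b₃)
      - δ * Δ * ((b₁ + d₁) * b₂ * b₃ * b₄ * b₅ + (b₂ + d₂) * b₁ * b₃ * b₄ * b₅ + (b₃ + d₃) * b₁ * b₂ * b₄ * b₅ + (b₄ + d₄) * b₁ * b₂ * b₃ * b₅ + (b₅ + d₅) * b₁ * b₂ * b₃ * b₄)
      + (Δ ^ 2 - 8 * δ ^ 2) * (b₁ * b₂ * b₃ * b₄ * b₅)
      = (Δ ^ 2 - 5 * Δ * δ + 2 * δ ^ 2) * (b₁ * b₂ * b₃ * b₄ * b₅) + δ * (4 * δ - Δ) * (d₁ * (b₂ * b₃ * b₄ * b₅) + d₂ * (b₁ * b₃ * b₄ * b₅) + d₃ * (b₁ * b₂ * b₄ * b₅) + d₄ * (b₁ * b₂ * b₃ * b₅) + d₅ * (b₁ * b₂ * b₃ * b₄))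
        + δ ^ 2 * (d₁ * d₂ * (b₃ * b₄ * b₅) + d₁ * d₃ * (b₂ * b₄ * b₅) + d₁ * d₄ * (b₂ * b₃ * b₅) + d₁ * d₅ * (b₂ * b₃ * b₄) + d₂ * d₃ * (b₁ * b₄ * b₅) + d₂ * d₄ * (b₁ * b₃ * b₅) + d₂ * d₅ * (b₁ * b₃ * b₄) + d₃ * d₄ * (b₁ * b₂ * b₅) + d₃ * d₅ * (b₁ * b₂ * b₄) + d₄ * d₅ * (b₁ * b₂ * b₃)) := by ring
  rw [e]
  have hP : 0 ≤ b₁ * b₂ * b₃ * b₄ * b₅ := by positivity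
  have hY : 0 ≤ d₁ * d₂ * (b₃ * b₄ * b₅) + d₁ * d₃ * (b₂ * b₄ * b₅) + d₁ * d₄ * (b₂ * b₃ * b₅) + d₁ * d₅ * (b₂ * b₃ * b₄) + d₂ * d₃ * (b₁ * b₄ * b₅) + d₂ * d₄ * (b₁ * b₃ * b₅) + d₂ * d₅ * (b₁ * b₃ * b₄) + d₃ * d₄ * (b₁ * b₂ * b₅) + d₃ * d₅ * (b₁ * b₂ * b₄) + d₄ * d₅ * (b₁ * b₂ * b₃) := by positivity
  have h4 : 0 ≤ 4 * δ - Δ := by linarith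
  have q₁ : (δ + Δ - 2 * b₁) * (b₂ * b₃ * b₄ * b₅) ≤ d₁ * (b₂ * b₃ * b₄ * b₅) :=
    mul_le_mul_of_nonneg_right hq₁ (by positivity)
  have q₂ : (δ + Δ - 2 * b₂) * (b₁ * b₃ * b₄ * b₅) ≤ d₂ * (b₁ * b₃ * b₄ * b₅) :=
    mul_le_mul_of_nonneg_right hq₂ (by positivity)
  have q₃ : (δ + Δ - 2 * b₃) * (b₁ * b₂ * b₄ * b₅) ≤ d₃ * (b₁ * b₂ * b₄ * b₅) :=
    mul_le_mul_of_nonneg_right hq₃ (by positivity)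
  have q₄ : (δ + Δ - 2 * b₄) * (b₁ * b₂ * b₃ * b₅) ≤ d₄ * (b₁ * b₂ * b₃ * b₅) :=
    mul_le_mul_of_nonneg_right hq₄ (by positivity)
  have q₅ : 0 ≤ d₅ * (b₁ * b₂ * b₃ * b₄) := by positivity
  have hX : (δ + Δ - 2 * b₁) * (b₂ * b₃ * b₄ * b₅) + (δ + Δ - 2 * b₂) * (b₁ * b₃ * b₄ * b₅) + (δ + Δ - 2 * b₃) * (b₁ * b₂ * b₄ * b₅) + (δ + Δ - 2 * b₄) * (b₁ * b₂ * b₃ * b₅)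
      ≤ d₁ * (b₂ * b₃ * b₄ * b₅) + d₂ * (b₁ * b₃ * b₄ * b₅) + d₃ * (b₁ * b₂ * b₄ * b₅) + d₄ * (b₁ * b₂ * b₃ * b₅) + d₅ * (b₁ * b₂ * b₃ * b₄) := by linarith only [q₁, q₂, q₃, q₄, q₅]
  have s1 := mul_le_mul_of_nonneg_left hX (mul_nonneg hδ h4)
  have hcoef : 0 ≤ (4 * δ - Δ) * (δ + Δ) := mul_nonneg h4 (by linarith)
  have s2 := mul_le_mul_of_nonneg_left hkey hcoef
  have hquad : 0 ≤ -29 * Δ ^ 2 + 117 * Δ * δ - 14 * δ ^ 2 := by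
    linarith only [mul_nonneg (show 0 ≤ 3 * Δ - δ by linarith) (show 0 ≤ 3 * δ - Δ by linarith),
      mul_nonneg hδ (show 0 ≤ Δ by linarith), mul_nonneg hδ hδ]
  have s3 : 0 ≤ (b₁ * b₂ * b₃ * b₄ * b₅) * (-29 * Δ ^ 2 + 117 * Δ * δ - 14 * δ ^ 2) := mul_nonneg hP hquad
  have s4 : 0 ≤ δ ^ 2 * (d₁ * d₂ * (b₃ * b₄ * b₅) + d₁ * d₃ * (b₂ * b₄ * b₅) + d₁ * d₄ * (b₂ * b₃ * b₅) + d₁ * d₅ * (b₂ * b₃ * b₄) + d₂ * d₃ * (b₁ * b₄ * b₅) + d₂ * d₄ * (b₁ * b₃ * b₅) + d₂ * d₅ * (b₁ * b₃ * b₄) + d₃ * d₄ * (b₁ * b₂ * b₅) + d₃ * d₅ * (b₁ * b₂ * b₄) + d₄ * d₅ * (b₁ * b₂ * b₃)) := mul_nonneg (sq_nonneg δ) hY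
  linarith only [s1, s2, s3, s4]

/-- LARGE TILT, one E-charge above: `Ψ_{4/3}(1) ≥ 0` once `3Δ² + 3Δδ ≥ 8δ²` (`Δ ≥ 0`): with `t_i = δa_i − Δb_i ≥ 0` (i ≤ 4, from
`a_i ≥ δ + Δ − b_i`, `b_i ≤ δ`) and `t₅ = δ(a₅ − b₅) ≥ 0` (ampleness w.r.t. `F₁` only),
`Ψ(1) = Σ_{i<j}t_it_jb_{∖ij} + (δ+2Δ)Σ_{i≤4}t_ib_{∖i} + 3Δ·t₅b_{∖5} + (3Δ²+3Δδ−8δ²)∏b`. -/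
theorem psi_low_largeTilt4 (a₁ a₂ a₃ a₄ a₅ b₁ b₂ b₃ b₄ b₅ δ Δ : ℝ)
    (hb₁ : 0 ≤ b₁) (hb₂ : 0 ≤ b₂) (hb₃ : 0 ≤ b₃) (hb₄ : 0 ≤ b₄) (hb₅ : 0 ≤ b₅)
    (hc₁ : b₁ ≤ δ) (hc₂ : b₂ ≤ δ) (hc₃ : b₃ ≤ δ) (hc₄ : b₄ ≤ δ)
    (ha₁ : δ + Δ - b₁ ≤ a₁) (ha₂ : δ + Δ - b₂ ≤ a₂) (ha₃ : δ + Δ - b₃ ≤ a₃) (ha₄ : δ + Δ - b₄ ≤ a₄) (ha₅ : b₅ ≤ a₅)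
    (hδ : 0 ≤ δ) (hΔ : 0 ≤ Δ) (hl : 8 * δ ^ 2 ≤ 3 * Δ ^ 2 + 3 * Δ * δ) :
    0 ≤ δ ^ 2 * (a₁ * a₂ * b₃ * b₄ * b₅ + a₁ * a₃ * b₂ * b₄ * b₅ + a₁ * a₄ * b₂ * b₃ * b₅ + a₁ * a₅ * b₂ * b₃ * b₄ + a₂ * a₃ * b₁ * b₄ * b₅ + a₂ * a₄ * b₁ * b₃ * b₅ + a₂ * a₅ * b₁ * b₃ * b₄ + a₃ * a₄ * b₁ * b₂ * b₅ + a₃ * a₅ * b₁ * b₂ * b₄ + a₄ * a₅ * b₁ * b₂ * b₃)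
      - δ * Δ * (a₁ * b₂ * b₃ * b₄ * b₅ + a₂ * b₁ * b₃ * b₄ * b₅ + a₃ * b₁ * b₂ * b₄ * b₅ + a₄ * b₁ * b₂ * b₃ * b₅ + a₅ * b₁ * b₂ * b₃ * b₄)
      + (Δ ^ 2 - 8 * δ ^ 2) * (b₁ * b₂ * b₃ * b₄ * b₅) := by
  have ht₁ : 0 ≤ δ * a₁ - Δ * b₁ := by
    linarith only [mul_le_mul_of_nonneg_left ha₁ hδ, mul_nonneg (add_nonneg hδ hΔ) (sub_nonneg.mpr hc₁)]
  have ht₂ : 0 ≤ δ * a₂ - Δ * b₂ := by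
    linarith only [mul_le_mul_of_nonneg_left ha₂ hδ, mul_nonneg (add_nonneg hδ hΔ) (sub_nonneg.mpr hc₂)]
  have ht₃ : 0 ≤ δ * a₃ - Δ * b₃ := by
    linarith only [mul_le_mul_of_nonneg_left ha₃ hδ, mul_nonneg (add_nonneg hδ hΔ) (sub_nonneg.mpr hc₃)]
  have ht₄ : 0 ≤ δ * a₄ - Δ * b₄ := by
    linarith only [mul_le_mul_of_nonneg_left ha₄ hδ, mul_nonneg (add_nonneg hδ hΔ) (sub_nonneg.mpr hc₄)]
  have ht₅ : 0 ≤ δ * a₅ - δ * b₅ := by linarith only [mul_le_mul_of_nonneg_left ha₅ hδ]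
  have e : δ ^ 2 * (a₁ * a₂ * b₃ * b₄ * b₅ + a₁ * a₃ * b₂ * b₄ * b₅ + a₁ * a₄ * b₂ * b₃ * b₅ + a₁ * a₅ * b₂ * b₃ * b₄ + a₂ * a₃ * b₁ * b₄ * b₅ + a₂ * a₄ * b₁ * b₃ * b₅ + a₂ * a₅ * b₁ * b₃ * b₄ + a₃ * a₄ * b₁ * b₂ * b₅ + a₃ * a₅ * b₁ * b₂ * b₄ + a₄ * a₅ * b₁ * b₂ * b₃)
      - δ * Δ * (a₁ * b₂ * b₃ * b₄ * b₅ + a₂ * b₁ * b₃ * b₄ * b₅ + a₃ * b₁ * b₂ * b₄ * b₅ + a₄ * b₁ * b₂ * b₃ * b₅ + a₅ * b₁ * b₂ * b₃ * b₄)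
      + (Δ ^ 2 - 8 * δ ^ 2) * (b₁ * b₂ * b₃ * b₄ * b₅)
      = ((δ * a₁ - Δ * b₁) * (δ * a₂ - Δ * b₂) * (b₃ * b₄ * b₅) + (δ * a₁ - Δ * b₁) * (δ * a₃ - Δ * b₃) * (b₂ * b₄ * b₅) + (δ * a₁ - Δ * b₁) * (δ * a₄ - Δ * b₄) * (b₂ * b₃ * b₅) + (δ * a₁ - Δ * b₁) * (δ * a₅ - δ * b₅) * (b₂ * b₃ * b₄) + (δ * a₂ - Δ * b₂) * (δ * a₃ - Δ * b₃) * (b₁ * b₄ * b₅) + (δ * a₂ - Δ * b₂) * (δ * a₄ - Δ * b₄) * (b₁ * b₃ * b₅) + (δ * a₂ - Δ * b₂) * (δ * a₅ - δ * b₅) * (b₁ * b₃ * b₄) + (δ * a₃ - Δ * b₃) * (δ * a₄ - Δ * b₄) * (b₁ * b₂ * b₅) + (δ * a₃ - Δ * b₃) * (δ * a₅ - δ * b₅) * (b₁ * b₂ * b₄) + (δ * a₄ - Δ * b₄) * (δ * a₅ - δ * b₅) * (b₁ * b₂ * b₃))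
        + (δ + 2 * Δ) * ((δ * a₁ - Δ * b₁) * (b₂ * b₃ * b₄ * b₅) + (δ * a₂ - Δ * b₂) * (b₁ * b₃ * b₄ * b₅) + (δ * a₃ - Δ * b₃) * (b₁ * b₂ * b₄ * b₅) + (δ * a₄ - Δ * b₄) * (b₁ * b₂ * b₃ * b₅))
        + 3 * Δ * ((δ * a₅ - δ * b₅) * (b₁ * b₂ * b₃ * b₄))
        + (3 * Δ ^ 2 + 3 * Δ * δ - 8 * δ ^ 2) * (b₁ * b₂ * b₃ * b₄ * b₅) := by ring
  rw [e]
  have hcoef : 0 ≤ 3 * Δ ^ 2 + 3 * Δ * δ - 8 * δ ^ 2 := by linarith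
  have hcoef2 : 0 ≤ δ + 2 * Δ := by linarith
  generalize (δ * a₁ - Δ * b₁) = T₁ at ht₁ ⊢
  generalize (δ * a₂ - Δ * b₂) = T₂ at ht₂ ⊢
  generalize (δ * a₃ - Δ * b₃) = T₃ at ht₃ ⊢
  generalize (δ * a₄ - Δ * b₄) = T₄ at ht₄ ⊢
  generalize (δ * a₅ - δ * b₅) = T₅ at ht₅ ⊢
  positivity

/-- **THE F₁-BRACKET WITH ONE E-CHARGE ABOVE THE TOP F-CHARGE.** Centring + (P4), sorted F-charges `v₁ ≤ v₂ ≤ v₃`, `v₁ < v₃`,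
nonnegative tilt `B₁ ≤ B₃`, `F₁` weakly below all E-charges, `u₁..u₄ ≤ v₃ ≤ u₅`, ampleness w.r.t. `F₁` (all e) and w.r.t. `F₃` (e ≤ 4) ⟹
`Ψ_{4/3}(1) ≥ 0` (the `hlow` expression of `allTilts_main`; with `Glam_delta_cubed_13`, `δ³(Q₂ + (4/3)Q₄) = 2(Ψ(1) − Ψ(3))`). -/
theorem psi1_nonneg_oneAbove (A₁ A₂ A₃ A₄ A₅ B₁ B₃ u₁ u₂ u₃ u₄ u₅ v₁ v₂ v₃ : ℝ)
    (hC : u₁ + u₂ + u₃ + u₄ + u₅ = v₁ + v₂ + v₃)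
    (hP4 : (u₁ ^ 3 + u₂ ^ 3 + u₃ ^ 3 + u₄ ^ 3 + u₅ ^ 3) - (v₁ ^ 3 + v₂ ^ 3 + v₃ ^ 3) = 0)
    (m₁₁ : |u₁ - v₁| ≤ A₁ - B₁) (m₂₁ : |u₂ - v₁| ≤ A₂ - B₁) (m₃₁ : |u₃ - v₁| ≤ A₃ - B₁) (m₄₁ : |u₄ - v₁| ≤ A₄ - B₁) (m₅₁ : |u₅ - v₁| ≤ A₅ - B₁)
    (m₁₃ : |u₁ - v₃| ≤ A₁ - B₃) (m₂₃ : |u₂ - v₃| ≤ A₂ - B₃) (m₃₃ : |u₃ - v₃| ≤ A₃ - B₃) (m₄₃ : |u₄ - v₃| ≤ A₄ - B₃)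
    (lo₁ : v₁ ≤ u₁) (lo₂ : v₁ ≤ u₂) (lo₃ : v₁ ≤ u₃) (lo₄ : v₁ ≤ u₄) (lo₅ : v₁ ≤ u₅)
    (hi₁ : u₁ ≤ v₃) (hi₂ : u₂ ≤ v₃) (hi₃ : u₃ ≤ v₃) (hi₄ : u₄ ≤ v₃) (hi₅ : v₃ ≤ u₅)
    (h12 : v₁ ≤ v₂) (h23 : v₂ ≤ v₃) (hB : B₁ ≤ B₃) (hlt : v₁ < v₃) :
    0 ≤ (v₃ - v₁) ^ 2 * ((A₁ - B₁) * (A₂ - B₁) * (u₃ - v₁) * (u₄ - v₁) * (u₅ - v₁)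
        + (A₁ - B₁) * (A₃ - B₁) * (u₂ - v₁) * (u₄ - v₁) * (u₅ - v₁)
        + (A₁ - B₁) * (A₄ - B₁) * (u₂ - v₁) * (u₃ - v₁) * (u₅ - v₁)
        + (A₁ - B₁) * (A₅ - B₁) * (u₂ - v₁) * (u₃ - v₁) * (u₄ - v₁)
        + (A₂ - B₁) * (A₃ - B₁) * (u₁ - v₁) * (u₄ - v₁) * (u₅ - v₁)
        + (A₂ - B₁) * (A₄ - B₁) * (u₁ - v₁) * (u₃ - v₁) * (u₅ - v₁)
        + (A₂ - B₁) * (A₅ - B₁) * (u₁ - v₁) * (u₃ - v₁) * (u₄ - v₁)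
        + (A₃ - B₁) * (A₄ - B₁) * (u₁ - v₁) * (u₂ - v₁) * (u₅ - v₁)
        + (A₃ - B₁) * (A₅ - B₁) * (u₁ - v₁) * (u₂ - v₁) * (u₄ - v₁)
        + (A₄ - B₁) * (A₅ - B₁) * (u₁ - v₁) * (u₂ - v₁) * (u₃ - v₁))
      - (v₃ - v₁) * (B₃ - B₁) * ((A₁ - B₁) * (u₂ - v₁) * (u₃ - v₁) * (u₄ - v₁) * (u₅ - v₁) + (A₂ - B₁) * (u₁ - v₁) * (u₃ - v₁) * (u₄ - v₁) * (u₅ - v₁) + (A₃ - B₁) * (u₁ - v₁) * (u₂ - v₁) * (u₄ - v₁) * (u₅ - v₁) + (A₄ - B₁) * (u₁ - v₁) * (u₂ - v₁) * (u₃ - v₁) * (u₅ - v₁) + (A₅ - B₁) * (u₁ - v₁) * (u₂ - v₁) * (u₃ - v₁) * (u₄ - v₁))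
      + ((B₃ - B₁) ^ 2 - 6 * (4 / 3) * (v₃ - v₁) ^ 2) * ((u₁ - v₁) * (u₂ - v₁) * (u₃ - v₁) * (u₄ - v₁) * (u₅ - v₁)) := by
  have hδ : 0 < v₃ - v₁ := sub_pos.mpr hlt
  have hΔ : 0 ≤ B₃ - B₁ := sub_nonneg.mpr hB
  have bp₁ : 0 ≤ u₁ - v₁ := sub_nonneg.mpr lo₁
  have bp₂ : 0 ≤ u₂ - v₁ := sub_nonneg.mpr lo₂
  have bp₃ : 0 ≤ u₃ - v₁ := sub_nonneg.mpr lo₃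
  have bp₄ : 0 ≤ u₄ - v₁ := sub_nonneg.mpr lo₄
  have bp₅ : 0 ≤ u₅ - v₁ := sub_nonneg.mpr lo₅
  have al₁ : u₁ - v₁ ≤ A₁ - B₁ := le_trans (le_abs_self _) m₁₁
  have al₂ : u₂ - v₁ ≤ A₂ - B₁ := le_trans (le_abs_self _) m₂₁
  have al₃ : u₃ - v₁ ≤ A₃ - B₁ := le_trans (le_abs_self _) m₃₁
  have al₄ : u₄ - v₁ ≤ A₄ - B₁ := le_trans (le_abs_self _) m₄₁
  have al₅ : u₅ - v₁ ≤ A₅ - B₁ := le_trans (le_abs_self _) m₅₁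
  have dl₁ : 0 ≤ (A₁ - B₁) - (u₁ - v₁) := sub_nonneg.mpr al₁
  have dl₂ : 0 ≤ (A₂ - B₁) - (u₂ - v₁) := sub_nonneg.mpr al₂
  have dl₃ : 0 ≤ (A₃ - B₁) - (u₃ - v₁) := sub_nonneg.mpr al₃
  have dl₄ : 0 ≤ (A₄ - B₁) - (u₄ - v₁) := sub_nonneg.mpr al₄
  have dl₅ : 0 ≤ (A₅ - B₁) - (u₅ - v₁) := sub_nonneg.mpr al₅
  have ah₁ : v₃ - u₁ ≤ A₁ - B₃ := by linarith only [neg_abs_le (u₁ - v₃), m₁₃]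
  have ah₂ : v₃ - u₂ ≤ A₂ - B₃ := by linarith only [neg_abs_le (u₂ - v₃), m₂₃]
  have ah₃ : v₃ - u₃ ≤ A₃ - B₃ := by linarith only [neg_abs_le (u₃ - v₃), m₃₃]
  have ah₄ : v₃ - u₄ ≤ A₄ - B₃ := by linarith only [neg_abs_le (u₄ - v₃), m₄₃]
  have hc₁ : u₁ - v₁ ≤ v₃ - v₁ := by linarith only [hi₁]
  have hc₂ : u₂ - v₁ ≤ v₃ - v₁ := by linarith only [hi₂]
  have hc₃ : u₃ - v₁ ≤ v₃ - v₁ := by linarith only [hi₃]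
  have hc₄ : u₄ - v₁ ≤ v₃ - v₁ := by linarith only [hi₄]
  have ha₁ : (v₃ - v₁) + (B₃ - B₁) - (u₁ - v₁) ≤ A₁ - B₁ := by linarith only [ah₁]
  have ha₂ : (v₃ - v₁) + (B₃ - B₁) - (u₂ - v₁) ≤ A₂ - B₁ := by linarith only [ah₂]
  have ha₃ : (v₃ - v₁) + (B₃ - B₁) - (u₃ - v₁) ≤ A₃ - B₁ := by linarith only [ah₃]
  have ha₄ : (v₃ - v₁) + (B₃ - B₁) - (u₄ - v₁) ≤ A₄ - B₁ := by linarith only [ah₄]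
  have hq₁ : (v₃ - v₁) + (B₃ - B₁) - 2 * (u₁ - v₁) ≤ (A₁ - B₁) - (u₁ - v₁) := by linarith only [ah₁]
  have hq₂ : (v₃ - v₁) + (B₃ - B₁) - 2 * (u₂ - v₁) ≤ (A₂ - B₁) - (u₂ - v₁) := by linarith only [ah₂]
  have hq₃ : (v₃ - v₁) + (B₃ - B₁) - 2 * (u₃ - v₁) ≤ (A₃ - B₁) - (u₃ - v₁) := by linarith only [ah₃]
  have hq₄ : (v₃ - v₁) + (B₃ - B₁) - 2 * (u₄ - v₁) ≤ (A₄ - B₁) - (u₄ - v₁) := by linarith only [ah₄]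
  have hc₅ : v₃ - v₁ ≤ u₅ - v₁ := by linarith only [hi₅]
  by_cases hs : (0 ≤ (B₃ - B₁) ^ 2 - 5 * (B₃ - B₁) * (v₃ - v₁) + 2 * (v₃ - v₁) ^ 2 ∧ B₃ - B₁ ≤ 4 * (v₃ - v₁))
  · have kl := psi_low_nonneg (u₁ - v₁) (u₂ - v₁) (u₃ - v₁) (u₄ - v₁) (u₅ - v₁)
      ((A₁ - B₁) - (u₁ - v₁)) ((A₂ - B₁) - (u₂ - v₁)) ((A₃ - B₁) - (u₃ - v₁)) ((A₄ - B₁) - (u₄ - v₁)) ((A₅ - B₁) - (u₅ - v₁)) (v₃ - v₁) (B₃ - B₁)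
      bp₁ bp₂ bp₃ bp₄ bp₅ dl₁ dl₂ dl₃ dl₄ dl₅ hδ.le hs.1 (by linarith only [hs.2])
    linear_combination kl
  · by_cases hl : 8 * (v₃ - v₁) ^ 2 ≤ 3 * (B₃ - B₁) ^ 2 + 3 * (B₃ - B₁) * (v₃ - v₁)
    · have kl := psi_low_largeTilt4 (A₁ - B₁) (A₂ - B₁) (A₃ - B₁) (A₄ - B₁) (A₅ - B₁) (u₁ - v₁) (u₂ - v₁) (u₃ - v₁) (u₄ - v₁) (u₅ - v₁) (v₃ - v₁) (B₃ - B₁)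
        bp₁ bp₂ bp₃ bp₄ bp₅ hc₁ hc₂ hc₃ hc₄ ha₁ ha₂ ha₃ ha₄ al₅ hδ.le hΔ hl
      linear_combination kl
    · have hhi' : B₃ - B₁ ≤ 3 * (v₃ - v₁) := by
        by_contra h'
        push Not at h'
        have h9 := mul_lt_mul'' h' h' (by linarith only [hδ]) (by linarith only [hδ])
        linarith only [h9, not_le.mp hl, mul_pos hδ hδ, mul_nonneg hΔ hδ.le]
      have hQ : B₃ - B₁ ≤ 4 * (v₃ - v₁) := by linarith only [hhi', hδ]
      have hPneg : (B₃ - B₁) ^ 2 - 5 * (B₃ - B₁) * (v₃ - v₁) + 2 * (v₃ - v₁) ^ 2 < 0 := by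
        by_contra hP'
        push Not at hP'
        exact hs ⟨hP', hQ⟩
      have hlo' : v₃ - v₁ ≤ 3 * (B₃ - B₁) := by
        by_contra h'
        push Not at h'
        linarith only [mul_lt_mul_of_pos_right h' hδ, sq_nonneg (B₃ - B₁), hPneg, hΔ, hδ, mul_pos hδ hδ]
      have hdd := dd2_of_pure u₁ u₂ u₃ u₄ u₅ v₁ v₂ v₃ hC hP4
      have hkey := key4 (u₁ - v₁) (u₂ - v₁) (u₃ - v₁) (u₄ - v₁) (u₅ - v₁) (v₃ - v₁) (v₂ - v₁)
        bp₁ bp₂ bp₃ bp₄ hc₁ hc₂ hc₃ hc₄ hc₅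
        (sub_nonneg.mpr h12) (by linarith only [h23]) hδ (by linear_combination hdd)
      have kl := psi_low_midTilt4 (u₁ - v₁) (u₂ - v₁) (u₃ - v₁) (u₄ - v₁) (u₅ - v₁)
        ((A₁ - B₁) - (u₁ - v₁)) ((A₂ - B₁) - (u₂ - v₁)) ((A₃ - B₁) - (u₃ - v₁)) ((A₄ - B₁) - (u₄ - v₁)) ((A₅ - B₁) - (u₅ - v₁)) (v₃ - v₁) (B₃ - B₁)
        bp₁ bp₂ bp₃ bp₄ bp₅ dl₁ dl₂ dl₃ dl₄ dl₅ hq₁ hq₂ hq₃ hq₄ hδ.le hlo' hhi' hkey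
      linear_combination kl

end Summit.HodgeConjecture.HodgeConjecture.WeilClassTestFormatFiveThreeLowBracket
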